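import Literature.Analysis.Calculus.MatrixFieldSmooth
import Literature.Analysis.FunctionSpaces.HolderChartRestriction
import Literature.Analysis.FunctionSpaces.ContDiffHolderDiffOperator
import Literature.Analysis.FunctionSpaces.HolderManifoldRegularity
import Literature.Geometry.Lorentzian.ChartLaplacian
import Literature.Geometry.Lorentzian.HessianLinear
import HarnessLib

/-!
# The Laplace–Beltrami operator is bounded `C^{k+2,r}_𝔄(M) → C^{k,r}_𝔄(M)` (Hölder spaces, part 15)

Topic `Literature/Analysis/FunctionSpaces`. For a smooth pseudo-Riemannian metric `g` on a compact
manifold `M` (model `𝓘(ℝ, E)`, `E` finite-dimensional) with Hölder chart data `𝔄` (part 4), the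
wave / Laplace–Beltrami operator `□_g = tr_g Hess` of the tree
(`Literature.Geometry.Lorentzian.PseudoRiemannianMetric.dalembertian`) maps `C^{k+2,r}_𝔄(M, ℝ)`
into `C^{k,r}_𝔄(M, ℝ)` and is a bounded linear operator
(`dalembertianCLM : C^{k+2,r}_𝔄(M, ℝ) →L[ℝ] C^{k,r}_𝔄(M, ℝ)`, `0 ≤ r ≤ 1`). This is
Gilbarg–Trudinger 2001, §6.1 ("`L : C^{2,α} → C^{α}` is bounded when the coefficients are
`C^{α}`") for the model geometric operator, and the first half of item (2c) of the census of
`Literature.Geometry.Riemannian.gurskyViaclovsky_pathOpen_weighted_four`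
(`L₀ = Δ_g − 1 : C^{2,α} → C^{0,α}`).

Construction. In the `j`-th chart the tree's coordinate formula
`□_g f = Ĝ^{ab}(∂_a∂_b f̂ − Γˡ_{ab} ∂ₗ f̂)` (`dalembertian_eq_sum_localFrame`, O'Neill 1983, Ch. 3,
Def. 3.50 ff.; coefficients `C^∞` on the chart target: `contDiffOn_gram_comp_extChartAt_symm`,
`det_gram_comp_extChartAt_symm_ne_zero`, `ContDiffOn.matrix_of_inv`) exhibits the `j`-th chart
piece of `□_g u` as `Q_j u`, where
`Q_j = coeffCLM(piece_j 1) ∘ localizedOperatorCLM(η_j; Ĝ⁻¹, −Ĝ⁻¹Γ, 0) ∘ chartRestrictCLM_j(η_j)`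
(parts 11, 13) for a cutoff `η_j = 1` near `chart_j(tsupport ρ_j)` (`piece_dalembertian_eq`);
hence `□_g u ∈ C^{k,r}_𝔄` with pieces depending continuously on `u`, and `dalembertianCLM` is
obtained from the closed graph theorem (part 9). Everything is proved; no named facts.

## References

* D. Gilbarg, N. S. Trudinger, *Elliptic Partial Differential Equations of Second Order* (2001),
  §6.1. [GilbargTrudinger2001]
* B. O'Neill, *Semi-Riemannian Geometry* (1983), Ch. 3, Def. 3.50 ff. [ONeill1983]
-/

noncomputable section

open Set Filter Topology Function
open scoped NNReal Manifold ContDiff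

namespace Literature.Analysis.FunctionSpaces

open Literature.Geometry.Lorentzian Literature.Analysis.Calculus

/-! ### An algebraic rearrangement -/

/-- `∑_{ab} A_{ab}(X_{ab} − ∑_l Γ_{abl} Y_l) = ∑_{ab} A_{ab} X_{ab} + ∑_l (−∑_{ab} A_{ab} Γ_{abl}) Y_l`.
[folklore] -/
theorem sum_mul_sub_sum_eq {κ : Type*} [Fintype κ] (A X : κ → κ → ℝ) (Γ : κ → κ → κ → ℝ)
    (Y : κ → ℝ) :
    ∑ a, ∑ b, A a b * (X a b - ∑ l, Γ a b l * Y l) =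
      (∑ a, ∑ b, A a b * X a b) + ∑ l, (-∑ a, ∑ b, A a b * Γ a b l) * Y l := by
  have hL : ∑ a, ∑ b, A a b * (X a b - ∑ l, Γ a b l * Y l) =
      (∑ a, ∑ b, A a b * X a b) - ∑ a, ∑ b, ∑ l, A a b * Γ a b l * Y l := by
    rw [← Finset.sum_sub_distrib]
    refine Finset.sum_congr rfl fun a _ => ?_
    rw [← Finset.sum_sub_distrib]
    refine Finset.sum_congr rfl fun b _ => ?_
    rw [mul_sub, Finset.mul_sum]
    simp only [mul_assoc]
  have hR : ∑ l, (-∑ a, ∑ b, A a b * Γ a b l) * Y l =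
      -∑ a, ∑ b, ∑ l, A a b * Γ a b l * Y l := by
    have h1 : ∀ l, (-∑ a, ∑ b, A a b * Γ a b l) * Y l = -∑ a, ∑ b, A a b * Γ a b l * Y l := by
      intro l
      rw [neg_mul, Finset.sum_mul]
      congr 1
      refine Finset.sum_congr rfl fun a _ => ?_
      rw [Finset.sum_mul]
    have h2 : ∑ l, ∑ a, ∑ b, A a b * Γ a b l * Y l = ∑ a, ∑ b, ∑ l, A a b * Γ a b l * Y l :=
      Finset.sum_comm.trans (Finset.sum_congr rfl fun a _ => Finset.sum_comm)
    simp only [h1, Finset.sum_neg_distrib, h2]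
  rw [hL, hR, sub_eq_add_neg]

/-! ### The chart coefficients of `□_g` -/

section Coefficients

variable {E : Type*} [NormedAddCommGroup E] [NormedSpace ℝ E] {M : Type*} [TopologicalSpace M]
  [ChartedSpace E M] [IsManifold 𝓘(ℝ, E) ∞ M]
  {κ : Type*} [Fintype κ] [DecidableEq κ] (bE : Module.Basis κ ℝ E)
  (g : PseudoRiemannianMetric 𝓘(ℝ, E) ∞ E (TangentSpace 𝓘(ℝ, E) : M → Type _)) (c : M)

/-- The metric coefficients `Ĝ_{ab}(y) = g(∂_a, ∂_b)(chart_c⁻¹ y)` of the chart centred at `c`.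
[folklore] -/
def gram (y : E) (a b : κ) : ℝ :=
  g.val ((extChartAt 𝓘(ℝ, E) c).symm y)
    ((trivializationAt E (TangentSpace 𝓘(ℝ, E)) c).localFrame bE a ((extChartAt 𝓘(ℝ, E) c).symm y))
    ((trivializationAt E (TangentSpace 𝓘(ℝ, E)) c).localFrame bE b ((extChartAt 𝓘(ℝ, E) c).symm y))

/-- The inverse metric coefficients `Ĝ^{ab}(y)`. [folklore] -/
def gramInv (y : E) (a b : κ) : ℝ := (Matrix.of (gram bE g c y))⁻¹ a b

/-- The Christoffel coefficients `Γˡ_{ab}(y) = ∑_k ½(∂_aĜ_{bk} + ∂_bĜ_{ak} − ∂_kĜ_{ab}) Ĝ^{kl}`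
(index pattern of `dalembertian_eq_sum_localFrame`). [folklore] -/
def christoffel (y : E) (a b l : κ) : ℝ :=
  ∑ k, 2⁻¹ * (fderiv ℝ (fun z => gram bE g c z b k) y (bE a) +
    fderiv ℝ (fun z => gram bE g c z a k) y (bE b) -
    fderiv ℝ (fun z => gram bE g c z a b) y (bE k)) * gramInv bE g c y k l

/-- The first-order coefficients `bˡ = −∑_{ab} Ĝ^{ab} Γˡ_{ab}`. [folklore] -/
def firstOrderCoeff (l : κ) (y : E) : ℝ := -∑ a, ∑ b, gramInv bE g c y a b * christoffel bE g c y a b l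

omit [Fintype κ] [DecidableEq κ] in
/-- The metric coefficients are `C^∞` on the chart target. [folklore] -/
theorem contDiffOn_gram (a b : κ) :
    ContDiffOn ℝ ∞ (fun y => gram bE g c y a b) (chartAt E c).target := by
  have h := contDiffOn_gram_comp_extChartAt_symm (I := 𝓘(ℝ, E)) (x₀ := c) bE g a b
  simp only [extChartAt_target, ModelWithCorners.range_eq_univ, modelWithCornersSelf_coe_symm,
    preimage_id_eq, id_eq, inter_univ] at h
  exact h

/-- The determinant of the metric coefficients does not vanish on the chart target. [folklore] -/
theorem det_gram_ne_zero {y : E} (hy : y ∈ (chartAt E c).target) :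
    (Matrix.of (gram bE g c y)).det ≠ 0 := by
  have hy' : y ∈ (extChartAt 𝓘(ℝ, E) c).target := by simpa using hy
  exact det_gram_comp_extChartAt_symm_ne_zero (I := 𝓘(ℝ, E)) bE g hy'

/-- The inverse metric coefficients are `C^∞` on the chart target. [folklore] -/
theorem contDiffOn_gramInv (a b : κ) :
    ContDiffOn ℝ ∞ (fun y => gramInv bE g c y a b) (chartAt E c).target :=
  ContDiffOn.matrix_of_inv (fun a b => contDiffOn_gram bE g c a b)
    (fun _ hy => det_gram_ne_zero bE g c hy) a b

omit [Fintype κ] [DecidableEq κ] in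
/-- Directional derivatives of the metric coefficients are `C^∞` on the chart target. [folklore] -/
theorem contDiffOn_fderiv_gram (a b : κ) (v : E) :
    ContDiffOn ℝ ∞ (fun y => fderiv ℝ (fun z => gram bE g c z a b) y v) (chartAt E c).target :=
  ((contDiffOn_gram bE g c a b).fderiv_of_isOpen (chartAt E c).open_target (by simp)).clm_apply
    contDiffOn_const

/-- The Christoffel coefficients are `C^∞` on the chart target. [folklore] -/
theorem contDiffOn_christoffel (a b l : κ) :
    ContDiffOn ℝ ∞ (fun y => christoffel bE g c y a b l) (chartAt E c).target := by
  unfold christoffel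
  refine ContDiffOn.sum fun k _ => ?_
  exact (contDiffOn_const.mul (((contDiffOn_fderiv_gram bE g c b k (bE a)).add
    (contDiffOn_fderiv_gram bE g c a k (bE b))).sub (contDiffOn_fderiv_gram bE g c a b (bE k)))).mul
    (contDiffOn_gramInv bE g c k l)

/-- The first-order coefficients are `C^∞` on the chart target. [folklore] -/
theorem contDiffOn_firstOrderCoeff (l : κ) :
    ContDiffOn ℝ ∞ (firstOrderCoeff bE g c l) (chartAt E c).target := by
  unfold firstOrderCoeff
  refine ContDiffOn.neg (ContDiffOn.sum fun a _ => ContDiffOn.sum fun b _ => ?_)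
  exact (contDiffOn_gramInv bE g c a b).mul (contDiffOn_christoffel bE g c a b l)

variable [FiniteDimensional ℝ E] [g.HasLeviCivita]

/-- **The chart formula for `□_g`** in the present notation: for `p` in the chart source and a
representative `fh` of `f` near `chart_c p`,
`□_g f (p) = ∑_{ab} Ĝ^{ab} D²fh(eₐ,e_b) + ∑_l bˡ Dfh(e_l)` at `y = chart_c p`
(`dalembertian_eq_sum_localFrame`, rearranged by `sum_mul_sub_sum_eq`). [cite: ONeill1983, Ch. 3, Def. 3.50 ff.] -/
theorem dalembertian_eq_coeff {p : M} (hp : p ∈ (chartAt E c).source) {f : M → ℝ}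
    (hf : CMDiffAt 2 f p) {fh : E → ℝ} (hfh : fh =ᶠ[𝓝 (chartAt E c p)] f ∘ (chartAt E c).symm) :
    g.dalembertian f p =
      (∑ a, ∑ b, gramInv bE g c (chartAt E c p) a b *
          fderiv ℝ (fderiv ℝ fh) (chartAt E c p) (bE a) (bE b)) +
        ∑ l, firstOrderCoeff bE g c l (chartAt E c p) * fderiv ℝ fh (chartAt E c p) (bE l) := by
  have hfh' : fh =ᶠ[𝓝 (extChartAt 𝓘(ℝ, E) c p)] f ∘ (extChartAt 𝓘(ℝ, E) c).symm := by
    have h1 : extChartAt 𝓘(ℝ, E) c p = chartAt E c p := by simp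
    have h2 : (f ∘ (extChartAt 𝓘(ℝ, E) c).symm) = f ∘ (chartAt E c).symm := by
      funext y
      simp
    rw [h1, h2]
    exact hfh
  have h := dalembertian_eq_sum_localFrame (I := 𝓘(ℝ, E)) g bE hp hf
    (Gh := gram bE g c) (Eventually.of_forall fun z a b => rfl) hfh'
  have h1 : extChartAt 𝓘(ℝ, E) c p = chartAt E c p := by simp
  rw [h1] at h
  rw [h]
  exact sum_mul_sub_sum_eq _ _ _ _

end Coefficients

/-! ### The operator -/

section Operator

variable {ι : Type*} [Fintype ι] {E : Type} [NormedAddCommGroup E] [NormedSpace ℝ E]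
  [FiniteDimensional ℝ E] {M : Type*} [TopologicalSpace M] [ChartedSpace E M]
  [IsManifold 𝓘(ℝ, E) ∞ M] [CompactSpace M] {k : ℕ} {r : ℝ≥0}

namespace HolderChartData

omit [Fintype ι] [IsManifold 𝓘(ℝ, E) ∞ M] in
/-- A cutoff `= 1` near `chart_j(tsupport ρ_j)` with compact support in the chart target exists.
[folklore] -/
theorem exists_cutoff (𝔄 : HolderChartData ι E M) (j : ι) : ∃ η : E → ℝ, ContDiff ℝ ∞ η ∧ HasCompactSupport η ∧
    tsupport η ⊆ (𝔄.chart j).target ∧ ∀ᶠ y in 𝓝ˢ (𝔄.chart j '' tsupport (𝔄.ρ j)), η y = 1 := by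
  obtain ⟨hc, hs⟩ := 𝔄.isCompact_image_tsupport j
  obtain ⟨η, h1, h2, h3, h4, -⟩ :=
    exists_contDiff_one_nhdsSet_of_isCompact hc (𝔄.chart j).open_target hs
  exact ⟨η, h1, h2, h3, h4⟩

/-- **The chart cutoffs** `η_j` (a choice). [folklore] -/
def cutoff (𝔄 : HolderChartData ι E M) (j : ι) : E → ℝ := Classical.choose (𝔄.exists_cutoff j)

omit [Fintype ι] [IsManifold 𝓘(ℝ, E) ∞ M] in
/-- The chart cutoffs are `C^∞`. [folklore] -/
theorem contDiff_cutoff (𝔄 : HolderChartData ι E M) (j : ι) : ContDiff ℝ ∞ (𝔄.cutoff j) :=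
  (Classical.choose_spec (𝔄.exists_cutoff j)).1

omit [Fintype ι] [IsManifold 𝓘(ℝ, E) ∞ M] in
/-- The chart cutoffs have compact support. [folklore] -/
theorem hasCompactSupport_cutoff (𝔄 : HolderChartData ι E M) (j : ι) : HasCompactSupport (𝔄.cutoff j) :=
  (Classical.choose_spec (𝔄.exists_cutoff j)).2.1

omit [Fintype ι] [IsManifold 𝓘(ℝ, E) ∞ M] in
/-- The chart cutoffs are supported in the chart targets. [folklore] -/
theorem tsupport_cutoff_subset (𝔄 : HolderChartData ι E M) (j : ι) : tsupport (𝔄.cutoff j) ⊆ (𝔄.chart j).target :=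
  (Classical.choose_spec (𝔄.exists_cutoff j)).2.2.1

omit [Fintype ι] [IsManifold 𝓘(ℝ, E) ∞ M] in
/-- The chart cutoffs are `= 1` near `chart_j(tsupport ρ_j)`. [folklore] -/
theorem cutoff_eq_one (𝔄 : HolderChartData ι E M) (j : ι) :
    ∀ᶠ y in 𝓝ˢ (𝔄.chart j '' tsupport (𝔄.ρ j)), 𝔄.cutoff j y = 1 :=
  (Classical.choose_spec (𝔄.exists_cutoff j)).2.2.2

end HolderChartData

/-- **The `j`-th chart piece of `□_g` as a bounded operator**
`Q_j = (piece_j 1)· ∘ η_j(Ĝ^{ab}∂_a∂_b + bˡ∂ₗ) ∘ (η_j · ∘ chart_j⁻¹) : C^{k+2,r}_𝔄(M, ℝ) →L[ℝ] C^{k,r}_b(E, ℝ)`.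
[cite: GilbargTrudinger2001, §6.1] -/
def dalembertianPieceCLM (𝔄 : HolderChartData ι E M) {κ : Type*} [Fintype κ] [DecidableEq κ] (bE : Module.Basis κ ℝ E) (g : PseudoRiemannianMetric 𝓘(ℝ, E) ∞ E (TangentSpace 𝓘(ℝ, E) : M → Type _)) [g.HasLeviCivita] (hr : r ≤ 1) (j : ι) :
    HolderManifoldFunction 𝔄 ℝ (k + 2) r →L[ℝ] ContDiffHolderFunction E ℝ k r :=
  (ContDiffHolderFunction.coeffCLM hr (𝔄.piece (fun _ : M => (1 : ℝ)) j)
      (𝔄.contDiff_piece contMDiff_const j) (𝔄.hasCompactSupport_piece _ j)).comp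
    ((ContDiffHolderFunction.localizedOperatorCLM hr (𝔄.cutoff j) (𝔄.contDiff_cutoff j)
        (𝔄.hasCompactSupport_cutoff j) (𝔄.chart j).open_target (𝔄.tsupport_cutoff_subset j) bE
        (fun a b y => gramInv bE g (𝔄.center j) y a b)
        (fun a b => contDiffOn_gramInv bE g (𝔄.center j) a b)
        (fun l y => firstOrderCoeff bE g (𝔄.center j) l y)
        (fun l => contDiffOn_firstOrderCoeff bE g (𝔄.center j) l) (fun _ => 0)
        contDiffOn_const).comp
      (chartRestrictCLM 𝔄 hr j (𝔄.cutoff j) (𝔄.contDiff_cutoff j) (𝔄.hasCompactSupport_cutoff j)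
        (𝔄.tsupport_cutoff_subset j)))

omit [FiniteDimensional ℝ E] [CompactSpace M] in
/-- Members of `C^{k+2,r}_𝔄` are `C²` at every point. [folklore] -/
theorem HolderManifoldFunction.contMDiffAt_two {𝔄 : HolderChartData ι E M}
    (u : HolderManifoldFunction 𝔄 ℝ (k + 2) r) (p : M) : CMDiffAt 2 (u : M → ℝ) p :=
  (u.contMDiff.of_le (by exact_mod_cast Nat.le_add_left 2 k)).contMDiffAt

/-- **The `j`-th chart piece of `□_g u` is `Q_j u`.** [cite: ONeill1983, Ch. 3, Def. 3.50 ff.] -/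
theorem dalembertianPieceCLM_apply_eq (𝔄 : HolderChartData ι E M) {κ : Type*} [Fintype κ] [DecidableEq κ] (bE : Module.Basis κ ℝ E) (g : PseudoRiemannianMetric 𝓘(ℝ, E) ∞ E (TangentSpace 𝓘(ℝ, E) : M → Type _)) [g.HasLeviCivita] (hr : r ≤ 1) (j : ι)
    (u : HolderManifoldFunction 𝔄 ℝ (k + 2) r) (y : E) :
    dalembertianPieceCLM 𝔄 bE g hr j u y = 𝔄.piece (g.dalembertian u) j y := by
  have hL : dalembertianPieceCLM 𝔄 bE g hr j u y =
      𝔄.piece (fun _ : M => (1 : ℝ)) j y * (𝔄.cutoff j y *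
        ((∑ a, ∑ b, gramInv bE g (𝔄.center j) y a b *
            fderiv ℝ (fderiv ℝ (chartRestrictCLM 𝔄 hr j (𝔄.cutoff j) (𝔄.contDiff_cutoff j)
              (𝔄.hasCompactSupport_cutoff j) (𝔄.tsupport_cutoff_subset j) u : E → ℝ)) y
              (bE a) (bE b)) +
          (∑ l, firstOrderCoeff bE g (𝔄.center j) l y *
            fderiv ℝ (chartRestrictCLM 𝔄 hr j (𝔄.cutoff j) (𝔄.contDiff_cutoff j)
              (𝔄.hasCompactSupport_cutoff j) (𝔄.tsupport_cutoff_subset j) u : E → ℝ) y (bE l)) +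
          0 * (chartRestrictCLM 𝔄 hr j (𝔄.cutoff j) (𝔄.contDiff_cutoff j)
              (𝔄.hasCompactSupport_cutoff j) (𝔄.tsupport_cutoff_subset j) u) y)) := by
    simp only [dalembertianPieceCLM, ContinuousLinearMap.coe_comp, Function.comp_apply,
      ContDiffHolderFunction.coeffCLM_apply, smul_eq_mul,
      ContDiffHolderFunction.localizedOperatorCLM_apply]
  rw [hL]
  by_cases hy : y ∈ (𝔄.chart j).target
  · set p := (𝔄.chart j).symm y with hp
    have hps : p ∈ (𝔄.chart j).source := (𝔄.chart j).map_target hy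
    have hyp : 𝔄.chart j p = y := (𝔄.chart j).right_inv hy
    rw [𝔄.piece_apply_of_mem _ hy, 𝔄.piece_apply_of_mem _ hy, smul_eq_mul, smul_eq_mul, mul_one]
    by_cases hρ : 𝔄.ρ j p = 0
    · rw [← hp, hρ, zero_mul, zero_mul]
    · -- `y` lies in `chart_j(tsupport ρ_j)`, where the cutoff is `1` nearby
      have hyK : y ∈ 𝔄.chart j '' tsupport (𝔄.ρ j) :=
        ⟨p, subset_closure (mem_support.2 hρ), hyp⟩
      have hev : ∀ᶠ z in 𝓝 y, 𝔄.cutoff j z = 1 :=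
        (𝔄.cutoff_eq_one j).filter_mono (nhds_le_nhdsSet hyK)
      have h1 : 𝔄.cutoff j y = 1 := hev.self_of_nhds
      have hfh : (chartRestrictCLM 𝔄 hr j (𝔄.cutoff j) (𝔄.contDiff_cutoff j)
          (𝔄.hasCompactSupport_cutoff j) (𝔄.tsupport_cutoff_subset j) u : E → ℝ) =ᶠ[𝓝 (𝔄.chart j p)]
          (u : M → ℝ) ∘ (𝔄.chart j).symm := by
        rw [hyp]
        filter_upwards [hev] with z hz
        rw [chartRestrictCLM_apply, hz, one_smul, Function.comp_apply]
      have hform := dalembertian_eq_coeff bE g (𝔄.center j) hps (u.contMDiffAt_two p) hfh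
      rw [hyp] at hform
      rw [← hp, hform, h1]
      ring
  · rw [𝔄.piece_apply_of_not_mem _ hy, 𝔄.piece_apply_of_not_mem _ hy, zero_mul]

/-- **The chart pieces of `□_g u` are in `C^{k,r}_b`** for `u ∈ C^{k+2,r}_𝔄(M, ℝ)`. [folklore] -/
theorem memContDiffHolder_piece_dalembertian (𝔄 : HolderChartData ι E M) (g : PseudoRiemannianMetric 𝓘(ℝ, E) ∞ E (TangentSpace 𝓘(ℝ, E) : M → Type _)) [g.HasLeviCivita] (hr : r ≤ 1)
    (u : HolderManifoldFunction 𝔄 ℝ (k + 2) r) (j : ι) :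
    MemContDiffHolder k r (𝔄.piece (g.dalembertian u) j) := by
  have h : 𝔄.piece (g.dalembertian u) j =
      (dalembertianPieceCLM 𝔄 (Module.finBasis ℝ E) g hr j u : E → ℝ) :=
    funext fun y => (dalembertianPieceCLM_apply_eq 𝔄 (Module.finBasis ℝ E) g hr j u y).symm
  rw [h]
  exact (dalembertianPieceCLM 𝔄 (Module.finBasis ℝ E) g hr j u).memContDiffHolder

/-- **`□_g u ∈ C^{k,r}_𝔄(M, ℝ)` for `u ∈ C^{k+2,r}_𝔄(M, ℝ).`** [cite: GilbargTrudinger2001, §6.1] -/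
def dalembertianFun (𝔄 : HolderChartData ι E M) (g : PseudoRiemannianMetric 𝓘(ℝ, E) ∞ E (TangentSpace 𝓘(ℝ, E) : M → Type _)) [g.HasLeviCivita] (hr : r ≤ 1) (u : HolderManifoldFunction 𝔄 ℝ (k + 2) r) :
    HolderManifoldFunction 𝔄 ℝ k r :=
  ⟨g.dalembertian u, fun j => memContDiffHolder_piece_dalembertian 𝔄 g hr u j⟩

/-- The underlying function of `dalembertianFun` is `□_g u`. [folklore] -/
@[simp]
theorem coe_dalembertianFun (𝔄 : HolderChartData ι E M) (g : PseudoRiemannianMetric 𝓘(ℝ, E) ∞ E (TangentSpace 𝓘(ℝ, E) : M → Type _)) [g.HasLeviCivita] (hr : r ≤ 1) (u : HolderManifoldFunction 𝔄 ℝ (k + 2) r) :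
    ((dalembertianFun 𝔄 g hr u : HolderManifoldFunction 𝔄 ℝ k r) : M → ℝ) = g.dalembertian u := rfl

/-- `□_g` as a linear map `C^{k+2,r}_𝔄(M, ℝ) →ₗ[ℝ] C^{k,r}_𝔄(M, ℝ)`. [folklore] -/
def dalembertianₗ (𝔄 : HolderChartData ι E M) (g : PseudoRiemannianMetric 𝓘(ℝ, E) ∞ E (TangentSpace 𝓘(ℝ, E) : M → Type _)) [g.HasLeviCivita] (hr : r ≤ 1) :
    HolderManifoldFunction 𝔄 ℝ (k + 2) r →ₗ[ℝ] HolderManifoldFunction 𝔄 ℝ k r where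
  toFun := dalembertianFun 𝔄 g hr
  map_add' u v := HolderManifoldFunction.ext fun x => by
    show g.dalembertian ((u : M → ℝ) + v) x = g.dalembertian u x + g.dalembertian v x
    exact g.dalembertian_add_of_contMDiffAt (u.contMDiffAt_two x) (v.contMDiffAt_two x)
  map_smul' a u := HolderManifoldFunction.ext fun x => by
    show g.dalembertian (fun y => a * u y) x = a * g.dalembertian u x
    exact g.dalembertian_const_mul_of_contMDiffAt (u.contMDiffAt_two x) a

/-- `dalembertianₗ 𝔄 g hr u x = □_g u (x)`. [folklore] -/
theorem dalembertianₗ_apply (𝔄 : HolderChartData ι E M) (g : PseudoRiemannianMetric 𝓘(ℝ, E) ∞ E (TangentSpace 𝓘(ℝ, E) : M → Type _)) [g.HasLeviCivita] (hr : r ≤ 1) (u : HolderManifoldFunction 𝔄 ℝ (k + 2) r)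
    (x : M) : dalembertianₗ 𝔄 g hr u x = g.dalembertian u x := rfl

/-- **Point evaluations of `□_g` factor through a chart piece**: if `ρ_j x ≠ 0` then
`□_g u (x) = Q_j u (chart_j x) · (ρ_j x)⁻¹`. [folklore] -/
theorem dalembertian_eq_piece_div (𝔄 : HolderChartData ι E M) {κ : Type*} [Fintype κ] [DecidableEq κ] (bE : Module.Basis κ ℝ E) (g : PseudoRiemannianMetric 𝓘(ℝ, E) ∞ E (TangentSpace 𝓘(ℝ, E) : M → Type _)) [g.HasLeviCivita] (hr : r ≤ 1) (u : HolderManifoldFunction 𝔄 ℝ (k + 2) r)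
    {j : ι} {x : M} (hx : 𝔄.ρ j x ≠ 0) :
    g.dalembertian u x = dalembertianPieceCLM 𝔄 bE g hr j u (𝔄.chart j x) * (𝔄.ρ j x)⁻¹ := by
  have hxs : x ∈ (𝔄.chart j).source := 𝔄.isSubordinate j (subset_closure (mem_support.2 hx))
  rw [dalembertianPieceCLM_apply_eq, ← 𝔄.smul_apply_eq_piece _ hxs, smul_eq_mul,
    mul_comm (𝔄.ρ j x), mul_assoc, mul_inv_cancel₀ hx, mul_one]

/-- **The Laplace–Beltrami / wave operator as a bounded operator**
`□_g : C^{k+2,r}_𝔄(M, ℝ) →L[ℝ] C^{k,r}_𝔄(M, ℝ)` (`r ≤ 1`). [cite: GilbargTrudinger2001, §6.1] -/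
def dalembertianCLM (𝔄 : HolderChartData ι E M) (g : PseudoRiemannianMetric 𝓘(ℝ, E) ∞ E (TangentSpace 𝓘(ℝ, E) : M → Type _)) [g.HasLeviCivita] (hr : r ≤ 1) :
    HolderManifoldFunction 𝔄 ℝ (k + 2) r →L[ℝ] HolderManifoldFunction 𝔄 ℝ k r :=
  HolderManifoldFunction.clmOfContinuousEval (dalembertianₗ 𝔄 g hr) fun x => by
    -- a chart index with `ρ_j x ≠ 0`
    have hsum : ∑ j, 𝔄.ρ j x ≠ 0 := by
      have h := 𝔄.sum_smul_eq x (1 : ℝ)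
      simp only [smul_eq_mul, mul_one] at h
      rw [h]
      exact one_ne_zero
    obtain ⟨j, -, hj⟩ := Finset.exists_ne_zero_of_sum_ne_zero hsum
    have heq : (fun u : HolderManifoldFunction 𝔄 ℝ (k + 2) r => dalembertianₗ 𝔄 g hr u x) =
        fun u => dalembertianPieceCLM 𝔄 (Module.finBasis ℝ E) g hr j u (𝔄.chart j x) *
          (𝔄.ρ j x)⁻¹ := by
      funext u
      rw [dalembertianₗ_apply]
      exact dalembertian_eq_piece_div 𝔄 (Module.finBasis ℝ E) g hr u hj
    rw [heq]
    exact ((ContDiffHolderFunction.evalCLM (E := E) (F := ℝ) (k := k) (r := r)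
      (𝔄.chart j x)).continuous.comp
      (dalembertianPieceCLM 𝔄 (Module.finBasis ℝ E) g hr j).continuous).mul continuous_const

/-- Pointwise: `dalembertianCLM 𝔄 g hr u x = □_g u (x)`. [folklore] -/
@[simp]
theorem dalembertianCLM_apply (𝔄 : HolderChartData ι E M) (g : PseudoRiemannianMetric 𝓘(ℝ, E) ∞ E (TangentSpace 𝓘(ℝ, E) : M → Type _)) [g.HasLeviCivita] (hr : r ≤ 1) (u : HolderManifoldFunction 𝔄 ℝ (k + 2) r)
    (x : M) : dalembertianCLM 𝔄 g hr u x = g.dalembertian u x := rfl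

end Operator

end Literature.Analysis.FunctionSpaces

end
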